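import Literature.AlgebraicGeometry.Frobenioids.ArithmeticRealificationFrobeniusTrivial
import Literature.AlgebraicGeometry.Frobenioids.ArithmeticFrobenioidsThm64SchemaClosures
import Mathlib.NumberTheory.Real.Irrational
import HarnessLib

/-!
# Frobenioids I, Theorem 6.4 (ii)–(iv) AT THE DATA with a FREE `picMap`: which binder of the schemata
# `Thm64iiDeg` / `Thm64ii` / `Thm64iii` / `Thm64iv` carries the printed content — PROOF-ONLY

Mochizuki, *The geometry of Frobenioids I: the general theory*, Kyushu J. Math. **62** (2008) 293–400, Thm. 6.4
(ii) p. 114, (iii) pp. 114–115, (iv) p. 115 [cite: MochizukiFrdI2008, Thm. 6.4 (ii) p.114]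
[cite: MochizukiFrdI2008, Thm. 6.4 (iii) p.114] [cite: MochizukiFrdI2008, Thm. 6.4 (iv) p.115].

PROOF-ONLY companion (cell abc-iut, F fact-proving wave, seat abc-iut-f-016; FROZEN FACT-LIST rows F-0889 `Thm64ii`,
F-0890 `Thm64iiDeg`, F-0891 `Thm64iii`, F-0892 `Thm64iv`; no `def`, no `instance`, no `structure`).  The companion
`ArithmeticFrobenioidsThm64SchemaClosures.lean` refutes the universal closures of the four schemata over JUNK
realification data.  This file evaluates them at THE data — abc-iut-L1-d2's `arithRealification hΦ`
(`C_{K/F}^rlf`, THE `Pic_Φ`, THE `δ_A`), over which the Frobenius-trivial quantifiers are NOT vacuous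
(abc-iut-L1-t3's `arithRealification_exists_isFrobeniusTrivial_over`) — keeping ONLY the binder `picMap` ("the
isomorphism `Pic_Φ(A₁) ⥲ Pic_Φ(A₂)` induced by `Ψ^rlf`", p. 114) free, and records in kernel:

* `ArithFrd.exists_picMap_delta_eq_mul` — since THE `δ_A : Pic_Φ(A) ⥲ ℝ` is an isomorphism for EVERY object, the
  transport `picMap := δ₂⁻¹ ∘ (c · ) ∘ δ₁` realises ANY real factor `c ≠ 0`; hence
* `ArithFrd.exists_picMap_thm64iiDeg_of_pos`, `ArithFrd.exists_picMap_thm64ii_of_any` — at THE data, for EVERY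
  equivalence `Ψ` and with NO [FrdI] Cor. 4.11 (iii) / Cor. 5.4 input, every `c > 0` is "a degree" of SOME `picMap`,
  and the bare shape `∃ picMap, Thm64ii R₁ R₂ Ψ picMap` holds: that shape is CONTENT-FREE, so a discharge of
  Thm. 6.4 (ii) must name THE induced `picMap` (as abc-iut-w4-d086's `ArithFrd.exists_picMap_thm64ii` does in its
  class-map conjunct `picMap_A [a] = (η_A)^*[Ψ^Φ a]`, p428396);
* `ArithFrd.not_forall_picMap_thm64ii`, `ArithFrd.not_forall_picMap_thm64iii`, `ArithFrd.not_forall_picMap_thm64iv_rat`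
  — conversely the schema LETTERS with `picMap` (and `deg`) universally quantified are FALSE even at THE
  realifications (with identity equivalences, identity comparison / realification functors, THE model Frobenioid
  `arithModelFrobenioid` and THE base functor; for (iv) over `F = K = ℚ`, where `Ψ^Base = 𝟭` is `1`-unique because
  `B(Gal(ℚ/ℚ))⁰` is contractible, `FinSubextCat.nonempty_iso_of_rat`): `picMap := -(δ⁻¹ ∘ δ)` has no positive
  degree, `picMap := δ⁻¹ ∘ (√2 · ) ∘ δ` has the irrational degree `√2`, `picMap := δ⁻¹ ∘ (2 · ) ∘ δ` has degree `2 ≠ 1`.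

So for each of the four rows the printed content is carried EXACTLY by binding `picMap` to THE isomorphism induced
by `Ψ^rlf` ([FrdI] Cor. 4.11 (iii) / Cor. 5.4) — neither by the universal closure nor by the bare existential.
Classical, undisputed mathematics; nothing here contradicts [FrdI] Thm. 6.4 or bears on [IUTchIII] Cor. 3.12; no
statement of the paper is strengthened; typed ≠ proved; no side taken.
-/

noncomputable section

namespace Literature.AlgebraicGeometry.Frobenioids

open CategoryTheory Opposite Literature.AnabelianGeometry.EtaleTheta

namespace ArithFrd

/-! ### Two sides: every non-zero real factor is realised by SOME `picMap` at THE data -/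

section TwoSides

variable {F₁ : Type} [Field F₁] [NumberField F₁] {K₁ : Type} [Field K₁] [Algebra F₁ K₁]
  {F₂ : Type} [Field F₂] [NumberField F₂] {K₂ : Type} [Field K₂] [Algebra F₂ K₂]
  (hΦ₁ : PreFrobenioid.IsPerfFactorialOn (arithDivisorFunctor F₁ K₁))
  (hΦ₂ : PreFrobenioid.IsPerfFactorialOn (arithDivisorFunctor F₂ K₂))
  (Ψ : PreFrobenioid.rlf (ModelFrobenioid.toElem (arithDivisorFunctor F₁ K₁) (unitsFunctor F₁ K₁) (divNatTrans F₁ K₁)) hΦ₁ ≌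
    PreFrobenioid.rlf (ModelFrobenioid.toElem (arithDivisorFunctor F₂ K₂) (unitsFunctor F₂ K₂) (divNatTrans F₂ K₂)) hΦ₂)

/-- **At THE data every real factor `c ≠ 0` is realised by a `picMap`.** For THE `ArithRealification`s
`arithRealification hΦ_i` and ANY equivalence `Ψ : C₁^rlf ⥲ C₂^rlf`, the transports
`picMap_A := δ_{Ψ A}⁻¹ ∘ (c · ) ∘ δ_A` are additive isomorphisms with `δ_{Ψ A} (picMap_A x) = c · δ_A x` for every
object `A` (THE `δ_A` being an isomorphism `Pic_Φ(A) ⥲ ℝ` for every `A`, Thm. 6.4 (i)).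
[cite: MochizukiFrdI2008, Thm. 6.4 (ii) p.114] -/
theorem exists_picMap_delta_eq_mul (c : ℝ) (hc : c ≠ 0) :
    ∃ picMap : ∀ A, (arithRealification hΦ₁).Pic A ≃+ (arithRealification hΦ₂).Pic (Ψ.functor.obj A),
      ∀ (A : PreFrobenioid.rlf (ModelFrobenioid.toElem (arithDivisorFunctor F₁ K₁) (unitsFunctor F₁ K₁)
          (divNatTrans F₁ K₁)) hΦ₁) (hA : (arithRealification hΦ₁).ops.IsFrobeniusTrivial A)
        (hA' : (arithRealification hΦ₂).ops.IsFrobeniusTrivial (Ψ.functor.obj A)) (x : (arithRealification hΦ₁).Pic A),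
        (arithRealification hΦ₂).δ _ hA' (picMap A x) = c * (arithRealification hΦ₁).δ A hA x := by
  refine ⟨fun A => ((ArithRlfPic.picDegreeAddEquiv hΦ₁ A.base).trans
      { toFun := fun x => c * x
        invFun := fun x => c⁻¹ * x
        left_inv := fun x => inv_mul_cancel_left₀ hc x
        right_inv := fun x => mul_inv_cancel_left₀ hc x
        map_add' := fun x y => mul_add c x y }).trans
      (ArithRlfPic.picDegreeAddEquiv hΦ₂ (Ψ.functor.obj A).base).symm, fun A hA hA' x => ?_⟩
  show ArithRlfPic.picDegreeAddEquiv hΦ₂ _ ((ArithRlfPic.picDegreeAddEquiv hΦ₂ _).symm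
      (c * ArithRlfPic.picDegreeAddEquiv hΦ₁ _ x)) = c * ArithRlfPic.picDegreeAddEquiv hΦ₁ _ x
  rw [AddEquiv.apply_symm_apply]

/-- **F-0890 / `Thm64iiDeg` at THE data with a free `picMap`: EVERY `c > 0` is "a degree".** For THE realifications
and ANY equivalence `Ψ`, some `picMap` satisfies `Thm64iiDeg (arithRealification hΦ₁) (arithRealification hΦ₂) Ψ picMap c`
— so `deg(Ψ^rlf)` is pinned only once `picMap` IS the isomorphism induced by `Ψ^rlf` (Cor. 4.11 (iii) / Cor. 5.4).
[cite: MochizukiFrdI2008, Thm. 6.4 (ii) p.114] -/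
theorem exists_picMap_thm64iiDeg_of_pos (c : ℝ) (hc : 0 < c) :
    ∃ picMap : ∀ A, (arithRealification hΦ₁).Pic A ≃+ (arithRealification hΦ₂).Pic (Ψ.functor.obj A),
      Literature.AlgebraicGeometry.Frobenioids.Thm64iiDeg (arithRealification hΦ₁) (arithRealification hΦ₂) Ψ picMap c := by
  obtain ⟨picMap, h⟩ := exists_picMap_delta_eq_mul hΦ₁ hΦ₂ Ψ c hc.ne'
  exact ⟨picMap, hc, h⟩

/-- **F-0889 / `Thm64ii` at THE data: the bare shape `∃ picMap, Thm64ii R₁ R₂ Ψ picMap` is CONTENT-FREE** — it holds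
for THE realifications and EVERY equivalence `Ψ` with no Cor. 4.11 (iii) / Cor. 5.4 input at all (`picMap :=
δ₂⁻¹ ∘ δ₁`, `deg := 1`); a discharge of Thm. 6.4 (ii) must therefore identify `picMap` with THE induced isomorphism
(abc-iut-w4-d086's `ArithFrd.exists_picMap_thm64ii`, class-map conjunct). [cite: MochizukiFrdI2008, Thm. 6.4 (ii) p.114] -/
theorem exists_picMap_thm64ii_of_any :
    ∃ picMap : ∀ A, (arithRealification hΦ₁).Pic A ≃+ (arithRealification hΦ₂).Pic (Ψ.functor.obj A),
      Literature.AlgebraicGeometry.Frobenioids.Thm64ii (arithRealification hΦ₁) (arithRealification hΦ₂) Ψ picMap := by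
  obtain ⟨picMap, h⟩ := exists_picMap_thm64iiDeg_of_pos hΦ₁ hΦ₂ Ψ 1 one_pos
  exact ⟨picMap, 1, h⟩

end TwoSides

/-! ### One side: the schema letters with a free `picMap` are false even at THE data -/

section OneSide

variable {F : Type} [Field F] [NumberField F] {K : Type} [Field K] [Algebra F K]
  (hΦ : PreFrobenioid.IsPerfFactorialOn (arithDivisorFunctor F K))

/-- **F-0889 / `Thm64ii` at THE data, `picMap` universally quantified: FALSE.** For THE realification `C_{K/F}^rlf`
and `Ψ^rlf = id`, the free `picMap := δ⁻¹ ∘ (-1 · ) ∘ δ` admits no `deg > 0`: test at a Frobenius-trivial object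
over `Spec F` (which exists, `arithRealification_exists_isFrobeniusTrivial_over`) and `x = δ⁻¹(1)`.
[cite: MochizukiFrdI2008, Thm. 6.4 (ii) p.114] -/
theorem not_forall_picMap_thm64ii :
    ¬ ∀ picMap : ∀ A, (arithRealification hΦ).Pic A ≃+
        (arithRealification hΦ).Pic ((CategoryTheory.Equivalence.refl
          (C := PreFrobenioid.rlf (ModelFrobenioid.toElem (arithDivisorFunctor F K) (unitsFunctor F K)
            (divNatTrans F K)) hΦ)).functor.obj A),
      Literature.AlgebraicGeometry.Frobenioids.Thm64ii (arithRealification hΦ) (arithRealification hΦ)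
        (CategoryTheory.Equivalence.refl) picMap := by
  intro h
  obtain ⟨s, hs⟩ := exists_picMap_delta_eq_mul hΦ hΦ (CategoryTheory.Equivalence.refl) (-1) (by norm_num)
  obtain ⟨deg, hdeg, hall⟩ := h s
  obtain ⟨A, -, hA⟩ := arithRealification_exists_isFrobeniusTrivial_over hΦ ⟨⊥⟩
  have h1 : (arithRealification hΦ).δ A hA (s A (((arithRealification hΦ).δ A hA).symm 1)) =
      deg * (arithRealification hΦ).δ A hA (((arithRealification hΦ).δ A hA).symm 1) := hall A hA hA _
  have h2 : (arithRealification hΦ).δ A hA (s A (((arithRealification hΦ).δ A hA).symm 1)) =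
      -1 * (arithRealification hΦ).δ A hA (((arithRealification hΦ).δ A hA).symm 1) := hs A hA hA _
  rw [AddEquiv.apply_symm_apply] at h1 h2
  linarith

/-- **F-0891 / `Thm64iii` at THE data, `picMap`/`deg` (and the comparison data) universally quantified: FALSE.**
For THE realification with `Ψ^rlf = Ψ' = id`, `u_i = id`, `placeMap = id`, the free `picMap := δ⁻¹ ∘ (√2 · ) ∘ δ` makes
the hypothesis `Thm64iiDeg … √2` TRUE while the conclusion `deg ∈ ℚ` fails. [cite: MochizukiFrdI2008, Thm. 6.4 (iii) p.114] -/
theorem not_forall_picMap_thm64iii :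
    ¬ ∀ (picMap : ∀ A, (arithRealification hΦ).Pic A ≃+
        (arithRealification hΦ).Pic ((CategoryTheory.Equivalence.refl
          (C := PreFrobenioid.rlf (ModelFrobenioid.toElem (arithDivisorFunctor F K) (unitsFunctor F K)
            (divNatTrans F K)) hΦ)).functor.obj A)) (deg : ℝ)
        (u₁ u₂ : PreFrobenioid.rlf (ModelFrobenioid.toElem (arithDivisorFunctor F K) (unitsFunctor F K)
            (divNatTrans F K)) hΦ ⥤
          PreFrobenioid.rlf (ModelFrobenioid.toElem (arithDivisorFunctor F K) (unitsFunctor F K) (divNatTrans F K)) hΦ)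
        (Ψ' : PreFrobenioid.rlf (ModelFrobenioid.toElem (arithDivisorFunctor F K) (unitsFunctor F K)
            (divNatTrans F K)) hΦ ≌
          PreFrobenioid.rlf (ModelFrobenioid.toElem (arithDivisorFunctor F K) (unitsFunctor F K) (divNatTrans F K)) hΦ)
        (A₁ : PreFrobenioid.rlf (ModelFrobenioid.toElem (arithDivisorFunctor F K) (unitsFunctor F K)
            (divNatTrans F K)) hΦ)
        (placeMap : Places ((arithRealification hΦ).ops.base.obj (u₁.obj A₁)).L ≃
          Places ((arithRealification hΦ).ops.base.obj (u₂.obj (Ψ'.functor.obj A₁))).L),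
      Literature.AlgebraicGeometry.Frobenioids.Thm64iii (arithRealification hΦ) (arithRealification hΦ)
        (CategoryTheory.Equivalence.refl) picMap deg u₁ u₂ Ψ' A₁ placeMap := by
  intro h
  obtain ⟨s, hs⟩ := exists_picMap_delta_eq_mul hΦ hΦ (CategoryTheory.Equivalence.refl) (Real.sqrt 2) (by positivity)
  obtain ⟨A, -, -⟩ := arithRealification_exists_isFrobeniusTrivial_over hΦ ⟨⊥⟩
  have hdeg : Literature.AlgebraicGeometry.Frobenioids.Thm64iiDeg (arithRealification hΦ) (arithRealification hΦ)
      (CategoryTheory.Equivalence.refl) s (Real.sqrt 2) := ⟨by positivity, hs⟩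
  have hcomm : OneCommutes (CategoryTheory.Equivalence.refl (C := PreFrobenioid.rlf (ModelFrobenioid.toElem
      (arithDivisorFunctor F K) (unitsFunctor F K) (divNatTrans F K)) hΦ)).functor (𝟭 _) (𝟭 _)
      (CategoryTheory.Equivalence.refl (C := PreFrobenioid.rlf (ModelFrobenioid.toElem
        (arithDivisorFunctor F K) (unitsFunctor F K) (divNatTrans F K)) hΦ)).functor := ⟨Iso.refl _⟩
  obtain ⟨⟨q, -, hq⟩, -⟩ := h s (Real.sqrt 2) (𝟭 _) (𝟭 _) (CategoryTheory.Equivalence.refl) A (Equiv.refl _) hdeg hcomm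
  exact irrational_sqrt_two ⟨q, hq.symm⟩

end OneSide

/-! ### Over `F = K = ℚ`: the letter of `Thm64iv` at THE data with a free `picMap` is false -/

section Rat

variable (hΦ : PreFrobenioid.IsPerfFactorialOn (arithDivisorFunctor ℚ ℚ))

/-- **F-0892 / `Thm64iv` at THE data over `ℚ/ℚ`, `picMap`/`deg` (and the realification functors, `Ψ`, `Ψ^Base`)
universally quantified: FALSE.** For THE realification `C_{ℚ/ℚ}^rlf`, THE model Frobenioid `C_{ℚ/ℚ}` with THE base
functor, `Ψ = Ψ^rlf = id`, constant "realification functors", `Ψ^Base = 𝟭` (an equivalence, `1`-commuting and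
`1`-unique since `B(Gal(ℚ/ℚ))⁰` is contractible), the free `picMap := δ⁻¹ ∘ (2 · ) ∘ δ` makes `Thm64iiDeg … 2` TRUE while
the conclusion `deg = 1` fails. [cite: MochizukiFrdI2008, Thm. 6.4 (iv) p.115] -/
theorem not_forall_picMap_thm64iv_rat :
    ¬ ∀ (picMap : ∀ A, (arithRealification hΦ).Pic A ≃+
        (arithRealification hΦ).Pic ((CategoryTheory.Equivalence.refl
          (C := PreFrobenioid.rlf (ModelFrobenioid.toElem (arithDivisorFunctor ℚ ℚ) (unitsFunctor ℚ ℚ)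
            (divNatTrans ℚ ℚ)) hΦ)).functor.obj A)) (deg : ℝ)
        (r₁ r₂ : arithFrobenioid ℚ ℚ ⥤
          PreFrobenioid.rlf (ModelFrobenioid.toElem (arithDivisorFunctor ℚ ℚ) (unitsFunctor ℚ ℚ) (divNatTrans ℚ ℚ)) hΦ)
        (Ψ : arithFrobenioid ℚ ℚ ≌ arithFrobenioid ℚ ℚ) (ΨBase : FinSubextCat ℚ ℚ ⥤ FinSubextCat ℚ ℚ),
      Literature.AlgebraicGeometry.Frobenioids.Thm64iv (arithRealification hΦ) (arithRealification hΦ)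
        (CategoryTheory.Equivalence.refl) picMap deg (arithModelFrobenioid ℚ ℚ) (arithModelFrobenioid ℚ ℚ)
        r₁ r₂ Ψ ΨBase := by
  intro h
  obtain ⟨s, hs⟩ := exists_picMap_delta_eq_mul hΦ hΦ (CategoryTheory.Equivalence.refl) 2 two_ne_zero
  obtain ⟨A₀, -, -⟩ := arithRealification_exists_isFrobeniusTrivial_over hΦ ⟨⊥⟩
  have hdeg : Literature.AlgebraicGeometry.Frobenioids.Thm64iiDeg (arithRealification hΦ) (arithRealification hΦ)
      (CategoryTheory.Equivalence.refl) s 2 := ⟨two_pos, hs⟩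
  let r : arithFrobenioid ℚ ℚ ⥤
      PreFrobenioid.rlf (ModelFrobenioid.toElem (arithDivisorFunctor ℚ ℚ) (unitsFunctor ℚ ℚ) (divNatTrans ℚ ℚ)) hΦ :=
    (Functor.const _).obj A₀
  have hcomm : OneCommutes (CategoryTheory.Equivalence.refl (C := arithFrobenioid ℚ ℚ)).functor r r
      (CategoryTheory.Equivalence.refl (C := PreFrobenioid.rlf (ModelFrobenioid.toElem
        (arithDivisorFunctor ℚ ℚ) (unitsFunctor ℚ ℚ) (divNatTrans ℚ ℚ)) hΦ)).functor :=
    ⟨r.leftUnitor ≪≫ r.rightUnitor.symm⟩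
  have hsq : PreFrobenioidData.OneUniqueSquare (CategoryTheory.Equivalence.refl (C := arithFrobenioid ℚ ℚ)).functor
      (arithModelFrobenioid ℚ ℚ).ops.base (arithModelFrobenioid ℚ ℚ).ops.base (𝟭 (FinSubextCat ℚ ℚ)) :=
    ⟨inferInstance, FinSubextCat.nonempty_iso_of_rat _ _, fun B' _ => FinSubextCat.nonempty_iso_of_rat _ _⟩
  obtain ⟨h1, -⟩ := h s 2 r r (CategoryTheory.Equivalence.refl) (𝟭 _) hdeg hcomm hsq
  norm_num at h1

end Rat

end ArithFrd

end Literature.AlgebraicGeometry.Frobenioids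

end
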